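import Summits.CriticalPhenomena.PercolationContinuityZ3.Theorems.PercNearOneGluingNoHeavyLowerTailSahiOneStepQHarrisPivot
import HarnessLib

/-!
# One-step scheme: a LOWER BOUND for the pivot bracket of `m′`, and Q-HARRIS when `H ⊆ A ∪ B` (Gladkov's Harris⁺, `k = 3`)

Support file (prover prim-ineq-prove-3 gen 16; `--supports stmt-CriticalPhenomena-4575`; memo
`run/shared/lean/prim/prim-ineq-prove-3/FINDING-G16-QHARRIS-PIVOT.md`).  No definitions, no named facts, no sorries, no `native_decide`.

`m′(H;A,B) = osMp p H (ind A) (ind B) = (1+μH)μ(HAB) − μ(H)μ(AB) − μ(HA)μ(HB)`; "Q-HARRIS" is the conjecture `m′ ≥ 0` for all increasing `H, A, B`.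
`…QHarrisPivot.osMp_ind_ind_pivot_eq`: `m′ = p_e·m′(¹) + q_e·m′(⁰) + p_e q_e·β_e` along every coordinate `e` (sections `X¹ = {ω | insert e ω ∈ X}`,
`X⁰ = {ω | ω ∖ {e} ∈ X}`).
* `bracket_ge_neg_mul` — for increasing `H, A, B` and EVERY `e`:  **`β_e ≥ −μ(G_e)·μ(K_e)`** with
  `G_e = {ω | ω∖{e} ∈ A∩B∖H, insert e ω ∈ H}` (the `Z → T` transitions at `e`) and `K_e = {ω | ω∖{e} ∉ H, insert e ω ∈ H∖(A∪B)}` (the transitions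
  from outside `H ∪ (A∩B)` into `H∖(A∪B)`).  In the memo's 17-piece expansion `β_e = P_e − [zt]_e·[lh]_e` with `P_e` a sum of 35 nonnegative products;
  this file keeps only the one negative product.
* `osMp_ind_ind_nonneg_of_pivot_of_null` — the inductive step needs only `m′(¹), m′(⁰) ≥ 0` and `μ(G_e)·μ(K_e) = 0`.
* **`osMp_ind_ind_nonneg_of_subset_union`** — Q-HARRIS for every increasing triple with `H ⊆ A ∪ B` (then `K_e = ∅` for all `e`; induction on the
  determining finset).  Under `H ⊆ A ∪ B` one has `H = (H∩A) ∪ (H∩B)` and `m′ = μ(T)·μ((A∩B ∪ H)ᶜ) − e₂(μ(HA∖B), μ(HB∖A), μ(AB∖H))`, `T = H∩A∩B`: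
  this is exactly the case `k = 3` of Gladkov's strong Harris–Kleitman inequality for events with equal pairwise intersections
  (tree: `Literature.Probability.LatticeModels.prodBernoulli_strongHarris`, Gladkov 2024 BLMS Thm. 2.1, with `s = Fin 3`,
  `A ↦ T`, `C ↦ (HA∖B, HB∖A, AB∖H)`), re-proved here inside the one-step vocabulary by the bracket bound — the point being that the
  bound closes an induction whenever the obstruction sets `K_e` are empty.  (Not restated in the three-event form to avoid duplication.)
-/

noncomputable section

namespace Summit.CriticalPhenomena.PercolationContinuityZ3.Theorems

namespace SahiOneStep

open MeasureTheory
open Literature.Probability.Percolation (DeterminedBy determinedBy_iff determinedBy_univ)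
open Literature.Probability.LatticeModels (prodBernoulli sahiE3 prodBernoulli_harris)
open Literature.Probability.Percolation.DecisionTree (ind)
open SahiE3Sections (determinedBy_section_insert determinedBy_section_sdiff)
open scoped Classical

variable {ι : Type*} [Fintype ι]

/-! ## Real-number skeleton of the bracket bound -/

omit [Fintype ι] in
/-- The arithmetic behind `bracket_ge_neg_mul`. [this work] -/
private theorem bracket_alg {du dv dc z1 z0 g kU kV kH k : ℝ}
    (hg : 0 ≤ g) (hkU : 0 ≤ kU) (hkV : 0 ≤ kV) (hdc : 0 ≤ dc) (hdv : 0 ≤ dv)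
    (hdu : g + kU ≤ du) (hdv' : g + kV ≤ dv) (hdc' : dc ≤ g + kH) (hz : z0 ≤ z1 + g) (hkH : kH ≤ kU + kV + k) :
    -(g * k) ≤ du * dv + dc * (z1 - z0) := by
  have p1 : 0 ≤ (du - g - kU) * dv := mul_nonneg (by linarith) hdv
  have p2 : 0 ≤ (g + kU) * (dv - g - kV) := mul_nonneg (by linarith) (by linarith)
  have p3 : 0 ≤ dc * (z1 - z0 + g) := mul_nonneg hdc (by linarith)
  have p4 : 0 ≤ (g + kH - dc) * g := mul_nonneg (by linarith) hg
  have p5 : 0 ≤ g * (kU + kV + k - kH) := mul_nonneg hg (by linarith)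
  have p6 : 0 ≤ kU * kV := mul_nonneg hkU hkV
  nlinarith [p1, p2, p3, p4, p5, p6]

/-! ## The bracket bound -/

/-- **Lower bound for the pivot bracket.**  For increasing `H, A, B` and every coordinate `e`:
`β_e ≥ −μ(G_e)·μ(K_e)`, `G_e = {ω | ω∖{e} ∈ A∩B∖H, insert e ω ∈ H}`, `K_e = {ω | ω∖{e} ∉ H, insert e ω ∈ H∖(A∪B)}`. [this work] -/
theorem bracket_ge_neg_mul (p : ι → unitInterval) {H A B : Set (Set ι)} (hH : IsUpperSet H) (hA : IsUpperSet A)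
    (hB : IsUpperSet B) (e : ι) :
    -((prodBernoulli p).real {ω : Set ι | ω \ {e} ∈ A ∧ ω \ {e} ∈ B ∧ ω \ {e} ∉ H ∧ insert e ω ∈ H} *
        (prodBernoulli p).real {ω : Set ι | ω \ {e} ∉ H ∧ insert e ω ∈ H ∧ insert e ω ∉ A ∧ insert e ω ∉ B}) ≤
      ((prodBernoulli p).real ({ω : Set ι | insert e ω ∈ H} ∩ {ω : Set ι | insert e ω ∈ A})
          - (prodBernoulli p).real ({ω : Set ι | ω \ {e} ∈ H} ∩ {ω : Set ι | ω \ {e} ∈ A})) *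
        ((prodBernoulli p).real ({ω : Set ι | insert e ω ∈ H} ∩ {ω : Set ι | insert e ω ∈ B})
          - (prodBernoulli p).real ({ω : Set ι | ω \ {e} ∈ H} ∩ {ω : Set ι | ω \ {e} ∈ B}))
      + ((prodBernoulli p).real {ω : Set ι | insert e ω ∈ H} - (prodBernoulli p).real {ω : Set ι | ω \ {e} ∈ H}) *
        (((prodBernoulli p).real ({ω : Set ι | insert e ω ∈ A} ∩ {ω : Set ι | insert e ω ∈ B})
            - (prodBernoulli p).real ({ω : Set ι | ω \ {e} ∈ A} ∩ {ω : Set ι | ω \ {e} ∈ B}))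
          - ((prodBernoulli p).real ({ω : Set ι | insert e ω ∈ H} ∩ {ω : Set ι | insert e ω ∈ A} ∩ {ω : Set ι | insert e ω ∈ B})
            - (prodBernoulli p).real ({ω : Set ι | ω \ {e} ∈ H} ∩ {ω : Set ι | ω \ {e} ∈ A} ∩ {ω : Set ι | ω \ {e} ∈ B}))) := by
  -- abbreviations
  set μ := prodBernoulli p with hμ
  set H1 : Set (Set ι) := {ω | insert e ω ∈ H} with hH1
  set H0 : Set (Set ι) := {ω | ω \ {e} ∈ H} with hH0
  set A1 : Set (Set ι) := {ω | insert e ω ∈ A} with hA1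
  set A0 : Set (Set ι) := {ω | ω \ {e} ∈ A} with hA0
  set B1 : Set (Set ι) := {ω | insert e ω ∈ B} with hB1
  set B0 : Set (Set ι) := {ω | ω \ {e} ∈ B} with hB0
  set G : Set (Set ι) := {ω | ω \ {e} ∈ A ∧ ω \ {e} ∈ B ∧ ω \ {e} ∉ H ∧ insert e ω ∈ H} with hG
  set K : Set (Set ι) := {ω | ω \ {e} ∉ H ∧ insert e ω ∈ H ∧ insert e ω ∉ A ∧ insert e ω ∉ B} with hK
  set KU : Set (Set ι) := {ω | ω \ {e} ∉ H ∧ ¬ (ω \ {e} ∈ A ∧ ω \ {e} ∈ B) ∧ insert e ω ∈ H ∧ insert e ω ∈ A} with hKU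
  set KV : Set (Set ι) := {ω | ω \ {e} ∉ H ∧ ¬ (ω \ {e} ∈ A ∧ ω \ {e} ∈ B) ∧ insert e ω ∈ H ∧ insert e ω ∈ B} with hKV
  set KH : Set (Set ι) := {ω | ω \ {e} ∉ H ∧ ¬ (ω \ {e} ∈ A ∧ ω \ {e} ∈ B) ∧ insert e ω ∈ H} with hKH
  -- monotonicity of sections
  have sub : ∀ ω : Set ι, ω \ {e} ⊆ insert e ω := fun ω => fun x hx => Set.mem_insert_of_mem e hx.1
  have upH : ∀ ω : Set ι, ω \ {e} ∈ H → insert e ω ∈ H := fun ω h => hH (sub ω) h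
  have upA : ∀ ω : Set ι, ω \ {e} ∈ A → insert e ω ∈ A := fun ω h => hA (sub ω) h
  have upB : ∀ ω : Set ι, ω \ {e} ∈ B → insert e ω ∈ B := fun ω h => hB (sub ω) h
  -- (1) du ≥ g + kU
  have diffU : μ.real ((H1 ∩ A1) \ (H0 ∩ A0)) = μ.real (H1 ∩ A1) - μ.real (H0 ∩ A0) := by
    rw [real_diff_eq]
    congr 2
    ext ω
    simp only [Set.mem_inter_iff, Set.mem_setOf_eq, hH1, hA1, hH0, hA0]
    constructor
    · rintro ⟨-, h⟩; exact h
    · rintro ⟨h1, h2⟩; exact ⟨⟨upH ω h1, upA ω h2⟩, h1, h2⟩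
  have GKU_sub : G ∪ KU ⊆ (H1 ∩ A1) \ (H0 ∩ A0) := by
    rintro ω (⟨ha, -, hnh, hh⟩ | ⟨hnh, -, hh, ha1⟩)
    · exact ⟨⟨hh, upA ω ha⟩, fun h => hnh h.1⟩
    · exact ⟨⟨hh, ha1⟩, fun h => hnh h.1⟩
  have GKU_disj : Disjoint G KU := by
    rw [Set.disjoint_left]
    rintro ω ⟨ha, hb, -, -⟩ ⟨-, hn, -, -⟩
    exact hn ⟨ha, hb⟩
  have du : μ.real G + μ.real KU ≤ μ.real (H1 ∩ A1) - μ.real (H0 ∩ A0) := by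
    rw [← diffU, ← measureReal_union GKU_disj MeasurableSet.of_discrete]
    exact measureReal_mono GKU_sub
  -- (2) dv ≥ g + kV
  have diffV : μ.real ((H1 ∩ B1) \ (H0 ∩ B0)) = μ.real (H1 ∩ B1) - μ.real (H0 ∩ B0) := by
    rw [real_diff_eq]
    congr 2
    ext ω
    simp only [Set.mem_inter_iff, Set.mem_setOf_eq, hH1, hB1, hH0, hB0]
    constructor
    · rintro ⟨-, h⟩; exact h
    · rintro ⟨h1, h2⟩; exact ⟨⟨upH ω h1, upB ω h2⟩, h1, h2⟩
  have GKV_sub : G ∪ KV ⊆ (H1 ∩ B1) \ (H0 ∩ B0) := by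
    rintro ω (⟨-, hb, hnh, hh⟩ | ⟨hnh, -, hh, hb1⟩)
    · exact ⟨⟨hh, upB ω hb⟩, fun h => hnh h.1⟩
    · exact ⟨⟨hh, hb1⟩, fun h => hnh h.1⟩
  have GKV_disj : Disjoint G KV := by
    rw [Set.disjoint_left]
    rintro ω ⟨ha, hb, -, -⟩ ⟨-, hn, -, -⟩
    exact hn ⟨ha, hb⟩
  have dv : μ.real G + μ.real KV ≤ μ.real (H1 ∩ B1) - μ.real (H0 ∩ B0) := by
    rw [← diffV, ← measureReal_union GKV_disj MeasurableSet.of_discrete]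
    exact measureReal_mono GKV_sub
  have dv0 : 0 ≤ μ.real (H1 ∩ B1) - μ.real (H0 ∩ B0) :=
    sub_nonneg.2 (measureReal_mono fun ω ⟨h1, h2⟩ => ⟨upH ω h1, upB ω h2⟩)
  -- (3) 0 ≤ dc ≤ g + kH
  have diffH : μ.real (H1 \ H0) = μ.real H1 - μ.real H0 := by
    rw [real_diff_eq]
    congr 2
    ext ω
    simp only [Set.mem_inter_iff, Set.mem_setOf_eq, hH1, hH0]
    constructor
    · rintro ⟨-, h⟩; exact h
    · intro h; exact ⟨upH ω h, h⟩
  have dc0 : 0 ≤ μ.real H1 - μ.real H0 := sub_nonneg.2 (measureReal_mono fun ω h => upH ω h)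
  have H_sub : H1 \ H0 ⊆ G ∪ KH := by
    rintro ω ⟨hh, hnh⟩
    by_cases hab : ω \ {e} ∈ A ∧ ω \ {e} ∈ B
    · exact Or.inl ⟨hab.1, hab.2, hnh, hh⟩
    · exact Or.inr ⟨hnh, hab, hh⟩
  have dc : μ.real H1 - μ.real H0 ≤ μ.real G + μ.real KH := by
    rw [← diffH]
    exact (measureReal_mono H_sub).trans (measureReal_union_le G KH)
  -- (4) z0 ≤ z1 + g
  have z1 : μ.real ((A1 ∩ B1) \ H1) = μ.real (A1 ∩ B1) - μ.real (H1 ∩ A1 ∩ B1) := by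
    rw [real_diff_eq]
    congr 2
    ext ω; simp only [Set.mem_inter_iff]; tauto
  have z0 : μ.real ((A0 ∩ B0) \ H0) = μ.real (A0 ∩ B0) - μ.real (H0 ∩ A0 ∩ B0) := by
    rw [real_diff_eq]
    congr 2
    ext ω; simp only [Set.mem_inter_iff]; tauto
  have Z_sub : (A0 ∩ B0) \ H0 ⊆ (A1 ∩ B1) \ H1 ∪ G := by
    rintro ω ⟨⟨ha, hb⟩, hnh⟩
    by_cases hh : insert e ω ∈ H
    · exact Or.inr ⟨ha, hb, hnh, hh⟩
    · exact Or.inl ⟨⟨upA ω ha, upB ω hb⟩, hh⟩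
  have dz : μ.real ((A0 ∩ B0) \ H0) ≤ μ.real ((A1 ∩ B1) \ H1) + μ.real G :=
    (measureReal_mono Z_sub).trans (measureReal_union_le _ _)
  -- (5) kH ≤ kU + kV + k
  have KH_sub : KH ⊆ KU ∪ KV ∪ K := by
    rintro ω ⟨hnh, hnab, hh⟩
    by_cases ha : insert e ω ∈ A
    · exact Or.inl (Or.inl ⟨hnh, hnab, hh, ha⟩)
    · by_cases hb : insert e ω ∈ B
      · exact Or.inl (Or.inr ⟨hnh, hnab, hh, hb⟩)
      · exact Or.inr ⟨hnh, hh, ha, hb⟩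
  have kH : μ.real KH ≤ μ.real KU + μ.real KV + μ.real K :=
    (measureReal_mono KH_sub).trans ((measureReal_union_le _ _).trans (by
      have := measureReal_union_le (μ := μ) KU KV; linarith))
  -- assemble
  have key := bracket_alg (du := μ.real (H1 ∩ A1) - μ.real (H0 ∩ A0)) (dv := μ.real (H1 ∩ B1) - μ.real (H0 ∩ B0))
    (dc := μ.real H1 - μ.real H0) (z1 := μ.real ((A1 ∩ B1) \ H1)) (z0 := μ.real ((A0 ∩ B0) \ H0))
    (g := μ.real G) (kU := μ.real KU) (kV := μ.real KV) (kH := μ.real KH) (k := μ.real K)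
    measureReal_nonneg measureReal_nonneg measureReal_nonneg dc0 dv0 du dv dc dz kH
  rw [z1, z0] at key
  linarith [key]

/-- **Inductive step with a null obstruction.**  If `m′ ≥ 0` on both section triples at `e` and `μ(G_e)·μ(K_e) = 0`, then `m′ ≥ 0`. [this work] -/
theorem osMp_ind_ind_nonneg_of_pivot_of_null (p : ι → unitInterval) {H A B : Set (Set ι)} (hH : IsUpperSet H)
    (hA : IsUpperSet A) (hB : IsUpperSet B) (e : ι)
    (h1 : 0 ≤ osMp p {ω : Set ι | insert e ω ∈ H} (ind {ω : Set ι | insert e ω ∈ A}) (ind {ω : Set ι | insert e ω ∈ B}))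
    (h0 : 0 ≤ osMp p {ω : Set ι | ω \ {e} ∈ H} (ind {ω : Set ι | ω \ {e} ∈ A}) (ind {ω : Set ι | ω \ {e} ∈ B}))
    (hnull : (prodBernoulli p).real {ω : Set ι | ω \ {e} ∈ A ∧ ω \ {e} ∈ B ∧ ω \ {e} ∉ H ∧ insert e ω ∈ H} *
        (prodBernoulli p).real {ω : Set ι | ω \ {e} ∉ H ∧ insert e ω ∈ H ∧ insert e ω ∉ A ∧ insert e ω ∉ B} = 0) :
    0 ≤ osMp p H (ind A) (ind B) := by
  rw [osMp_ind_ind_pivot_eq p H A B e]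
  have hβ := bracket_ge_neg_mul p hH hA hB e
  rw [hnull, neg_zero] at hβ
  have hp0 : 0 ≤ (p e : ℝ) := (p e).2.1
  have hq0 : 0 ≤ 1 - (p e : ℝ) := sub_nonneg.2 (p e).2.2
  have t1 := mul_nonneg hp0 h1
  have t2 := mul_nonneg hq0 h0
  have t3 := mul_nonneg (mul_nonneg hp0 hq0) hβ
  linarith

/-! ## Q-HARRIS when `H ⊆ A ∪ B` (Gladkov's Harris⁺ for three events) -/

omit [Fintype ι] in
/-- An event determined by no coordinate is `∅` or `univ` (local copy; cf. `…SahiCombMasterFamily`). [folklore] -/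
private theorem empty_or_univ_of_determinedBy_empty {X : Set (Set ι)} (hX : DeterminedBy X (((∅ : Finset ι)) : Set ι)) :
    X = ∅ ∨ X = Set.univ := by
  rw [determinedBy_iff] at hX
  by_cases h : (∅ : Set ι) ∈ X
  · right; ext ω
    simp only [Set.mem_univ, iff_true]
    exact (hX ∅ ω (by simp)).1 h
  · left; ext ω
    simp only [Set.mem_empty_iff_false, iff_false]
    exact fun hω => h ((hX ω ∅ (by simp)).1 hω)

/-- Base case: `m′ = 0` when `A` and `B` are trivial events. [this work] -/
private theorem osMp_ind_ind_nonneg_of_trivial (p : ι → unitInterval) (H : Set (Set ι)) {A B : Set (Set ι)}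
    (hA : A = ∅ ∨ A = Set.univ) (hB : B = ∅ ∨ B = Set.univ) : 0 ≤ osMp p H (ind A) (ind B) := by
  rw [osMp_ind_ind]
  have h1 : (prodBernoulli p).real (Set.univ : Set (Set ι)) = 1 := probReal_univ
  rcases hA with rfl | rfl
  · simp only [Set.inter_empty, Set.empty_inter, measureReal_empty, mul_zero, zero_mul, sub_zero, le_refl]
  · rcases hB with rfl | rfl
    · simp only [Set.inter_empty, measureReal_empty, mul_zero, sub_zero, le_refl]
    · simp only [Set.inter_univ, h1]
      nlinarith [measureReal_nonneg (μ := prodBernoulli p) (s := H)]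

/-- **Q-HARRIS for `H ⊆ A ∪ B`.**  For increasing `H, A, B ⊆ 2^ι` with `H ⊆ A ∪ B` and every product measure:
`(1 + μH)·μ(H∩A∩B) ≥ μ(H)·μ(A∩B) + μ(H∩A)·μ(H∩B)`.  (Induction on the determining finset; at each coordinate the obstruction set
`K_e = {ω | ω∖{e} ∉ H, insert e ω ∈ H∖(A∪B)}` is empty.)  Equivalent to the `k = 3` case of the tree's
`Literature.Probability.LatticeModels.prodBernoulli_strongHarris` (Gladkov's Harris⁺); new proof. [this work] -/
theorem osMp_ind_ind_nonneg_of_subset_union (p : ι → unitInterval) {H A B : Set (Set ι)} (hH : IsUpperSet H)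
    (hA : IsUpperSet A) (hB : IsUpperSet B) (hHAB : H ⊆ A ∪ B) : 0 ≤ osMp p H (ind A) (ind B) := by
  suffices key : ∀ G : Finset ι, ∀ H A B : Set (Set ι), IsUpperSet H → IsUpperSet A → IsUpperSet B →
      DeterminedBy H ((G : Finset ι) : Set ι) → DeterminedBy A ((G : Finset ι) : Set ι) → DeterminedBy B ((G : Finset ι) : Set ι) →
      H ⊆ A ∪ B → 0 ≤ osMp p H (ind A) (ind B) by
    have hu : ∀ X : Set (Set ι), DeterminedBy X (((Finset.univ : Finset ι)) : Set ι) := fun X => by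
      rw [Finset.coe_univ]; exact SahiE3Sections.determinedBy_univ_set X
    exact key Finset.univ H A B hH hA hB (hu H) (hu A) (hu B) hHAB
  intro G
  induction G using Finset.induction_on with
  | empty =>
    intro H A B _ _ _ _ hAG hBG _
    exact osMp_ind_ind_nonneg_of_trivial p H (empty_or_univ_of_determinedBy_empty hAG)
      (empty_or_univ_of_determinedBy_empty hBG)
  | insert e G _ ih =>
    intro H A B hH hA hB hHG hAG hBG hHAB
    have hsub : (((insert e G : Finset ι)) : Set ι) \ {e} ⊆ (((G : Finset ι)) : Set ι) := by
      intro i hi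
      simp only [Set.mem_sdiff, Finset.mem_coe, Finset.mem_insert, Set.mem_singleton_iff] at hi
      rcases hi with ⟨rfl | h, hne⟩
      · exact absurd rfl hne
      · exact h
    have hH1 : DeterminedBy {ω : Set ι | insert e ω ∈ H} (((G : Finset ι)) : Set ι) := (determinedBy_section_insert hHG e).mono hsub
    have hH0 : DeterminedBy {ω : Set ι | ω \ {e} ∈ H} (((G : Finset ι)) : Set ι) := (determinedBy_section_sdiff hHG e).mono hsub
    have hA1 : DeterminedBy {ω : Set ι | insert e ω ∈ A} (((G : Finset ι)) : Set ι) := (determinedBy_section_insert hAG e).mono hsub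
    have hA0 : DeterminedBy {ω : Set ι | ω \ {e} ∈ A} (((G : Finset ι)) : Set ι) := (determinedBy_section_sdiff hAG e).mono hsub
    have hB1 : DeterminedBy {ω : Set ι | insert e ω ∈ B} (((G : Finset ι)) : Set ι) := (determinedBy_section_insert hBG e).mono hsub
    have hB0 : DeterminedBy {ω : Set ι | ω \ {e} ∈ B} (((G : Finset ι)) : Set ι) := (determinedBy_section_sdiff hBG e).mono hsub
    have h1 := ih _ _ _ (isUpperSet_section_insert hH e) (isUpperSet_section_insert hA e) (isUpperSet_section_insert hB e)
      hH1 hA1 hB1 (fun ω hω => hHAB hω)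
    have h0 := ih _ _ _ (isUpperSet_section_sdiff hH e) (isUpperSet_section_sdiff hA e) (isUpperSet_section_sdiff hB e)
      hH0 hA0 hB0 (fun ω hω => hHAB hω)
    refine osMp_ind_ind_nonneg_of_pivot_of_null p hH hA hB e h1 h0 ?_
    have hK : {ω : Set ι | ω \ {e} ∉ H ∧ insert e ω ∈ H ∧ insert e ω ∉ A ∧ insert e ω ∉ B} = ∅ := by
      ext ω
      simp only [Set.mem_setOf_eq, Set.mem_empty_iff_false, iff_false, not_and, not_not]
      intro _ hh ha
      rcases hHAB hh with h | h
      · exact absurd h ha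
      · exact h
    rw [hK, measureReal_empty, mul_zero]

end SahiOneStep

end Summit.CriticalPhenomena.PercolationContinuityZ3.Theorems
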